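import Literature.NumberTheory.Automorphic.UnitarySimilitudeCentralTorusDecomposition
import Literature.NumberTheory.Automorphic.UnitaryIsotropicAbelianization
import HarnessLib

/-!
# Kottwitz's `D = G ∕ G^{der}` on points: the kernel and the image of `(det, c) : GU(J) → D_n`,
# `SU(J) = ker`, surjectivity for `n` odd (and for split `J`), the multiplier group `c(GU(J))`

Topic `NumberTheory/Automorphic`, namespace `Literature.NumberTheory.Automorphic.UnitarySimilitude` (lane
`lit-hodgefound`, Track 2 foundations; seat `lit-hodgefound-p11`, generation 31, row g31-#1 + rider g31-#1b = §4).  THEOREMS ONLY (D-0026): no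
definition, no named fact, no instance, no notation.  Sequel of ✔ `Automorphic/UnitarySimilitudeNormTorus` (g30-#4: the
similitude group on points `GU(J)(A) ≤ GL_n(R) × Aˣ`, Kottwitz's torus `D_n(A) = {(x, t) : σ(x) x = ι(t)ⁿ} ≤ Rˣ × Aˣ` and the
homomorphism `δ = (det, c) : GU(J)(A) → D_n(A)`, whose docstring records «that `G → D` identifies `G/G^{der}` with `D` is NOT
proved here»), of ✔ `Automorphic/UnitarySimilitudeCentralTorusDecomposition` (g30-#5: scalar similitudes) and of
✔ `Automorphic/UnitaryIsotropicAbelianization` (`UnitaryIsotropic.exists_det_eq_units`: `det : U(J) → N¹(σ)` is onto,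
Dieudonné's quasi-symmetries).  This file supplies the identification ON POINTS OVER A FIELD.

## The print, verbatim

R. E. Kottwitz, *Points on some Shimura varieties over finite fields*, J. Amer. Math. Soc. **5** (1992) 373–444
[Kottwitz1992], §7 pp. 393–394 (held text `paper:doi-10-2307-2152772`, p0021 L33–L43, p0022 L1–L9):

«In Cases A and C the group `G` is connected and reductive […]. Moreover in Cases A and C the derived group of `G` is
simply connected. […] In Cases A and C, we write `D` for the torus obtained as the quotient of `G` by its derived group
[…]. In Case A the group `G₁` is the restriction of scalars from `F₀` to `ℚ` of an inner form of a quasi-split unitary group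
over `F₀` determined by the quadratic extension `F/F₀`; we write `n` for the dimension of the Hermitian vector space giving
rise to this unitary group.  Then the torus `D` is the subtorus of `F^× × 𝔾_m` defined by the condition `N_{F/F₀} x = tⁿ`
(`x ∈ F^×`, `t ∈ 𝔾_m`). If `n` is even, say `n = 2k` […]. If `n` is odd, say `n = 2k + 1`, then `D` is isomorphic to the
subtorus of `F^×` consisting of elements whose norm down to `F₀` belongs to `𝔾_m`, the isomorphism being given by
`(x, t) ↦ x t^{-k}`.»  §5 p. 389 (p0017 L27–L29): «let `G` be the algebraic group over `ℚ` whose points in any `ℚ`-algebra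
`R` are given by `{x ∈ C ⊗_ℚ R | x x* ∈ R^×}`, and let `G₁` be the subgroup whose `R`-points are given by
`{x ∈ C ⊗_ℚ R | x x* = 1}`.»

J. Dieudonné, *La géométrie des groupes classiques*, 3e éd. (1971) [Dieudonne1971GroupesClassiques], Chap. II §5: for a
non-degenerate hermitian form over a commutative field the determinant maps `U_n(K, f)` ONTO the norm-one group and
`SU_n = U_n ∩ SL_n` (the tree's `UnitaryIsotropic.exists_det_eq_units` / `range_det_eq_ker_norm`).

## What is formalised (points in a tower `A →ι R ⟲ σ`; then `R = K` a field)

As in g30-#4, `R`, `A` are commutative rings, `σ : R →+* R` (conjugation), `ι : A →+* R` (structure map of the base) with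
`σ ∘ ι = ι` where needed; the groups enter through their MEMBERSHIP conditions (no definition is introduced):
`hG : p ∈ G ↔ ᵗσ(p.1) J p.1 = ι(p.2) J` (`G = GU(J)(A) ≤ GL_n(R) × Aˣ`, the multiplier recorded as the second coordinate),
`hD : p ∈ D m ↔ σ(p.1) p.1 = ι(p.2)^m` (`D_m(A) ≤ Rˣ × Aˣ`), `hδ : δ p = (det p.1, p.2)` (`δ = (det, c) : G →* D_n`, `n = #n`),
`hj : j u = (u, 1)` (`j : U(J) →* G`), `hc : c p = p.2` (`c : G →* Aˣ`, the multiplier character).  For Kottwitz's data take a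
CM field `F`, `R = F ⊗ A'`, `σ = conj ⊗ 1`, `ι = 1 ⊗ (·)`; the statements below, natural in `A'`, are then statements about
the `A'`-points of `G`, `G₁ = U`, `G^{der} = SU` and `D`, and §2 (a field `K` with involution `σ ≠ 1`, `2 ≠ 0`) is the case of
a field `A' ⊇ F₀` not containing `F` … or simply `R = F`, `A = F₀`.

* §1 (any commutative tower) `exists_monoidHom_inl` (the embedding `j : U(J)(A) → GU(J)(A)`, `u ↦ (u, 1)`, injective),
  `exists_monoidHom_snd` (the multiplier `c`), **`mem_range_inl_iff`** / `ker_snd_eq_range_inl` (`U(J) = ker c`: Kottwitz's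
  `G₁ = {x : x x* = 1}` inside `G = {x : x x* ∈ R^×}`), **`mem_ker_det_iff`** (`ker δ = {det = 1, c = 1}`),
  **`ker_eq_map_ker_det`** / `exists_mulEquiv_ker` (`ker δ = j(SU(J)) ≅ SU(J) = ker(det|U(J))` — the derived group of the
  print on points, cf. `UnitaryIsotropic.commutator_eq_ker_det`), `snd_mem_range_of_map_mul_eq` (a base unit `t` with
  `ι t = σ(z) z` a norm is a multiplier: the scalar similitude `(z·1, t)`), **`exists_map_mul_eq_of_mem_of_card_eq`** (`n = 2k+1`
  odd: the multiplier of EVERY similitude is a norm, `ι c(g) = N(det g · ι(c g)^{-k})` — the shear identity of g30-#4),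
  **`mem_range_snd_iff_of_card_eq`** (`n` odd: `c(GU(J)(A)) = {t : ι t ∈ N(Rˣ)}` exactly).
* §2 (`R = K` a field, `σ` an involution with `σ θ₀ = −θ₀ ≠ 0`, `2 ≠ 0`, `J` hermitian non-degenerate of non-zero size)
  **`exists_mem_det_eq`** (inside a fibre of `c` EVERY `x` with `N x = ι(t)ⁿ` is a determinant: multiply by `u ∈ U(J)` with
  `det u = x / det g₀ ∈ N¹`, Dieudonné), **`mem_range_iff_snd_mem_range`** (for `d ∈ D_n`: `d ∈ im δ ⟺ d.2 ∈ im c` — the image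
  of `(det, c)` is `D_n ∩ (Rˣ × c(G))`, any parity), `range_eq_top_of_range_snd_eq_top`,
  **`surjective_of_card_eq`** (`n = 2k + 1` ODD: `(det, c) : GU(J)(A) → D_n(A)` is ONTO — `t = N(x ι(t)^{-k})` is a norm, so
  `(x ι(t)^{-k}·1, t) ∈ G` has the right multiplier, and `U(J)` corrects the determinant), **`exists_mulEquiv_quotient_ker`**
  (`n` odd: `GU(J)(A) ∕ SU(J)(A)·{1} ≃* D_n(A)`, `[g] ↦ (det g, c(g))` — Kottwitz's «`D` = the quotient of `G` by its derived
  group» on points), and the matrix-level headline **`exists_similitude_det_eq_of_card_eq`** (`n` odd: every `(x, t)` with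
  `σ(x) x = ι(t)ⁿ` is `(det g, c(g))` for a `g` with `ᵗσ(g) J g = ι(t) J`).
* §3 (any commutative tower, index `m ⊕ m`) the SPLIT even case `J = [[0, 1], [1, 0]]` (the quasi-split unitary group in
  `2|m|` variables): `fromBlocks_smul_one_similitude` (`g_t = diag(ι(t)·1, 1)` is a similitude with multiplier `ι t`),
  private bookkeeping (`(J.map σ)ᵀ = J`, `det J` a unit, `g_t ∈ GL`), **`range_snd_eq_top_of_fromBlocks`**
  (every base unit is a multiplier) and, over a field, **`surjective_of_fromBlocks`** (`(det, c)` is onto `D_{2|m|}` for the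
  split form) — so the failure of surjectivity on points for `n` even is a phenomenon of NON-split forms only (e.g. `c(GU(2))`
  of a definite form over `ℝ` is `ℝ_{>0}`; not formalised).
* §4 (rider g31-#1b; the derived group read on `A`-points) `commutator_le_ker` (`GU′ ≤ ker (det, c)`, any tower),
  **`commutator_eq_ker`** / **`commutator_eq_map_ker_det`** (`J` with an ISOTROPIC vector
  over a field: `GU(J)(A)′ = ker (det, c) = j(SU(J)(A))`, through ✔ `UnitaryIsotropic.commutator_eq_ker_det`, Dieudonné's
  `U′ = SU`), **`bijective_abelianizationLift`** / **`exists_mulEquiv_abelianization`** (`n` odd, `J` isotropic: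
  `GU(J)(A)^{ab} ≃* D_n(A)`, `[(g, t)] ↦ (det g, t)` — `D` IS the maximal abelian quotient of `G` on points).

Nothing on Galois cohomology / the Hasse principle (`ker¹(ℚ, D) = ker¹(ℚ, G)`) is formalised; HC is not advanced by this
file beyond Layer-C support (the abelianisation of `GU` for the unitary Shimura data of DAG-C rows C3-06 / C3-07).

## References

* [Kottwitz1992] R. E. Kottwitz, *Points on some Shimura varieties over finite fields*, J. Amer. Math. Soc. 5 (1992),
  §5 p. 389, §7 pp. 393–394.
* [Dieudonne1971GroupesClassiques] J. Dieudonné, *La géométrie des groupes classiques*, 3e éd. (1971), Chap. II §5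
  (`SU_n`, determinants of unitary groups over commutative fields).
* [RapoportSmithlingZhang2017] M. Rapoport, B. Smithling, W. Zhang, *Arithmetic diagonal cycles on unitary Shimura
  varieties*, arXiv 1710.06962, §3.1 (the groups `G^ℚ ⊂ Res GU(W)`, `c : G → 𝔾_m`).
-/

open scoped Matrix

namespace Literature.NumberTheory.Automorphic.UnitarySimilitude

/-! ## §1 Any commutative tower: `U(J) = ker c`, `ker (det, c) = SU(J) × {1}`, the multiplier group for `n` odd -/

section Tower

variable {R A : Type*} [CommRing R] [CommRing A] (σ : R →+* R) (ι : A →+* R) {n : Type*} [Fintype n]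
  [DecidableEq n] {J : Matrix n n R} {G : Subgroup (GL n R × Aˣ)}

/-- **The embedding `j : U(J)(A) ↪ GU(J)(A)`, `u ↦ (u, 1)`** (Kottwitz's `G₁ ⊂ G`: a unitary matrix is a similitude with
multiplier `1`); it is an injective group homomorphism. [cite: Kottwitz1992, §5 p. 389] -/
theorem exists_monoidHom_inl
    (hG : ∀ p, p ∈ G ↔ ((p.1 : Matrix n n R).map σ)ᵀ * J * (p.1 : Matrix n n R) = ι (p.2 : A) • J) :
    ∃ j : ↥(unitaryGroupOfForm σ J) →* G, Function.Injective j ∧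
      ∀ u, ((j u : G) : GL n R × Aˣ) = ((u : GL n R), 1) := by
  have hmem : ∀ u : ↥(unitaryGroupOfForm σ J), (((u : GL n R), (1 : Aˣ)) : GL n R × Aˣ) ∈ G := fun u =>
    (mk_one_mem_iff σ ι hG (u : GL n R)).2 (mem_unitaryGroupOfForm_iff.1 u.2)
  refine ⟨(((MonoidHom.inl (GL n R) Aˣ).comp (unitaryGroupOfForm σ J).subtype).codRestrict G hmem), ?_,
    fun u => rfl⟩
  intro u v huv
  have h := congrArg (fun p : G => ((p : GL n R × Aˣ)).1) huv
  exact Subtype.ext h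

/-- **The multiplier character `c : GU(J)(A) → Aˣ`**, `(g, t) ↦ t` (Kottwitz's `c : G → 𝔾_m`, «the scalar `c(g)` such that
`(gv, gw) = c (v, w)`»). [cite: Kottwitz1992, §7 p. 395] -/
theorem exists_monoidHom_snd (G : Subgroup (GL n R × Aˣ)) :
    ∃ c : G →* Aˣ, ∀ p, c p = ((p : GL n R × Aˣ)).2 :=
  ⟨(MonoidHom.snd (GL n R) Aˣ).comp G.subtype, fun _ => rfl⟩

/-- **`U(J) = ker c`**: a member of `GU(J)(A)` with multiplier coordinate `1` is `(u, 1)` for a unique `u ∈ U(J)(A)`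
(`G₁ = {x ∈ G : x x* = 1}`). [cite: Kottwitz1992, §5 p. 389] -/
theorem mem_range_inl_iff
    (hG : ∀ p, p ∈ G ↔ ((p.1 : Matrix n n R).map σ)ᵀ * J * (p.1 : Matrix n n R) = ι (p.2 : A) • J)
    {j : ↥(unitaryGroupOfForm σ J) →* G} (hj : ∀ u, ((j u : G) : GL n R × Aˣ) = ((u : GL n R), 1)) (p : G) :
    p ∈ j.range ↔ ((p : GL n R × Aˣ)).2 = 1 := by
  constructor
  · rintro ⟨u, rfl⟩
    rw [hj]
  · intro hp
    have hmem : ((p : GL n R × Aˣ)).1 ∈ unitaryGroupOfForm σ J := by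
      rw [mem_unitaryGroupOfForm_iff, ← mk_one_mem_iff σ ι hG, ← hp, Prod.mk.eta]
      exact p.2
    refine ⟨⟨_, hmem⟩, Subtype.ext ?_⟩
    rw [hj]
    exact Prod.ext rfl hp.symm

/-- `ker c = j(U(J))` as subgroups of `GU(J)(A)`. [cite: Kottwitz1992, §5 p. 389] -/
theorem ker_snd_eq_range_inl
    (hG : ∀ p, p ∈ G ↔ ((p.1 : Matrix n n R).map σ)ᵀ * J * (p.1 : Matrix n n R) = ι (p.2 : A) • J)
    {j : ↥(unitaryGroupOfForm σ J) →* G} (hj : ∀ u, ((j u : G) : GL n R × Aˣ) = ((u : GL n R), 1))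
    {c : G →* Aˣ} (hc : ∀ p, c p = ((p : GL n R × Aˣ)).2) : c.ker = j.range := by
  ext p
  rw [MonoidHom.mem_ker, hc, mem_range_inl_iff σ ι hG hj]

/-- **`ker (det, c) = {(g, t) : det g = 1, t = 1}`** on points. [cite: Kottwitz1992, §7 p. 393] -/
theorem mem_ker_det_iff {m : ℕ} {D : ℕ → Subgroup (Rˣ × Aˣ)} {δ : G →* D m}
    (hδ : ∀ p : G, ((δ p : D m) : Rˣ × Aˣ) = (Matrix.GeneralLinearGroup.det (p : GL n R × Aˣ).1, (p : GL n R × Aˣ).2))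
    (p : G) : p ∈ δ.ker ↔ Matrix.GeneralLinearGroup.det ((p : GL n R × Aˣ)).1 = 1 ∧ ((p : GL n R × Aˣ)).2 = 1 := by
  rw [MonoidHom.mem_ker, ← Subtype.coe_inj, hδ, OneMemClass.coe_one, Prod.mk_eq_one]

/-- **`ker (det, c) = j(SU(J))`**: the kernel of `(det, c) : GU(J)(A) → D_n(A)` is the image of
`SU(J)(A) = ker (det : U(J)(A) → Rˣ)` under `u ↦ (u, 1)` — on points, Kottwitz's derived group `G^{der}` (simply connected,
`= SU` in Case A). [cite: Kottwitz1992, §7 p. 393] [cite: Dieudonne1971GroupesClassiques, Chap. II §5] -/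
theorem ker_eq_map_ker_det
    (hG : ∀ p, p ∈ G ↔ ((p.1 : Matrix n n R).map σ)ᵀ * J * (p.1 : Matrix n n R) = ι (p.2 : A) • J)
    {j : ↥(unitaryGroupOfForm σ J) →* G} (hj : ∀ u, ((j u : G) : GL n R × Aˣ) = ((u : GL n R), 1))
    {m : ℕ} {D : ℕ → Subgroup (Rˣ × Aˣ)} {δ : G →* D m}
    (hδ : ∀ p : G, ((δ p : D m) : Rˣ × Aˣ) = (Matrix.GeneralLinearGroup.det (p : GL n R × Aˣ).1, (p : GL n R × Aˣ).2)) :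
    δ.ker = ((Matrix.GeneralLinearGroup.det.comp (unitaryGroupOfForm σ J).subtype).ker).map j := by
  ext p
  rw [mem_ker_det_iff hδ, Subgroup.mem_map]
  constructor
  · rintro ⟨hdet, hsnd⟩
    obtain ⟨u, hu⟩ := (mem_range_inl_iff σ ι hG hj p).2 hsnd
    refine ⟨u, ?_, hu⟩
    rw [MonoidHom.mem_ker, MonoidHom.comp_apply, Subgroup.subtype_apply]
    have h1 : ((j u : G) : GL n R × Aˣ).1 = (u : GL n R) := by rw [hj]
    rw [← h1, hu]
    exact hdet
  · rintro ⟨u, hu, rfl⟩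
    rw [MonoidHom.mem_ker, MonoidHom.comp_apply, Subgroup.subtype_apply] at hu
    rw [hj]
    exact ⟨hu, rfl⟩

/-- `SU(J)(A) ≅ ker (det, c)` through `u ↦ (u, 1)`. [cite: Kottwitz1992, §7 p. 393] -/
theorem exists_mulEquiv_ker
    (hG : ∀ p, p ∈ G ↔ ((p.1 : Matrix n n R).map σ)ᵀ * J * (p.1 : Matrix n n R) = ι (p.2 : A) • J)
    {j : ↥(unitaryGroupOfForm σ J) →* G} (hjinj : Function.Injective j)
    (hj : ∀ u, ((j u : G) : GL n R × Aˣ) = ((u : GL n R), 1))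
    {m : ℕ} {D : ℕ → Subgroup (Rˣ × Aˣ)} {δ : G →* D m}
    (hδ : ∀ p : G, ((δ p : D m) : Rˣ × Aˣ) = (Matrix.GeneralLinearGroup.det (p : GL n R × Aˣ).1, (p : GL n R × Aˣ).2)) :
    ∃ e : ↥((Matrix.GeneralLinearGroup.det.comp (unitaryGroupOfForm σ J).subtype).ker) ≃* ↥δ.ker,
      ∀ u, ((e u : ↥δ.ker) : G) = j (u : ↥(unitaryGroupOfForm σ J)) := by
  have hker := ker_eq_map_ker_det σ ι hG hj hδ
  refine ⟨((Matrix.GeneralLinearGroup.det.comp (unitaryGroupOfForm σ J).subtype).ker.equivMapOfInjective j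
      hjinj).trans (MulEquiv.subgroupCongr hker.symm), fun u => rfl⟩

/-- **Norms are multipliers**: if `σ(z) z = ι t` then `t = c(z·1, t)` is a multiplier — the scalar similitude of
✔ `UnitarySimilitudeCentralTorusDecomposition.scalar_mk_mem` (RSZ's central `Z^ℚ ⊂ G^ℚ`).
[cite: Kottwitz1992, §7 p. 394] [cite: RapoportSmithlingZhang2017, §3.1] -/
theorem snd_mem_range_of_map_mul_eq
    (hG : ∀ p, p ∈ G ↔ ((p.1 : Matrix n n R).map σ)ᵀ * J * (p.1 : Matrix n n R) = ι (p.2 : A) • J)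
    {c : G →* Aˣ} (hc : ∀ p, c p = ((p : GL n R × Aˣ)).2) {z : Rˣ} {t : Aˣ}
    (hz : Units.map (σ : R →* R) z * z = Units.map (ι : A →* R) t) : t ∈ c.range :=
  ⟨⟨(Matrix.GeneralLinearGroup.scalar n z, t), scalar_mk_mem σ ι hG hz⟩, by rw [hc]⟩

/-- **`n = 2k + 1` odd: the multiplier of every similitude is a norm**, `ι c(g) = σ(y) y` with
`y = det g · ι(c g)^{-k}` (take determinants: `σ(det g) det g = ι(c g)^{2k+1}`, then shear by `ι(c g)^{-k}` — Kottwitz's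
`(x, t) ↦ x t^{-k}`). [cite: Kottwitz1992, §7 p. 394] -/
theorem exists_map_mul_eq_of_mem_of_card_eq (hσι : ∀ a, σ (ι a) = ι a) (hJ : IsUnit J.det)
    (hG : ∀ p, p ∈ G ↔ ((p.1 : Matrix n n R).map σ)ᵀ * J * (p.1 : Matrix n n R) = ι (p.2 : A) • J)
    {k : ℕ} (hn : Fintype.card n = 2 * k + 1) {p : GL n R × Aˣ} (hp : p ∈ G) :
    Units.map (σ : R →* R) (Matrix.GeneralLinearGroup.det p.1 / Units.map (ι : A →* R) p.2 ^ k) *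
        (Matrix.GeneralLinearGroup.det p.1 / Units.map (ι : A →* R) p.2 ^ k) = Units.map (ι : A →* R) p.2 := by
  have hdet : Units.map (σ : R →* R) (Matrix.GeneralLinearGroup.det p.1) * Matrix.GeneralLinearGroup.det p.1 =
      Units.map (ι : A →* R) p.2 ^ (1 + 2 * k) := by
    ext
    rw [Units.val_mul, Units.coe_map, MonoidHom.coe_coe, Matrix.GeneralLinearGroup.val_det_apply,
      Units.val_pow_eq_pow_val, Units.coe_map, MonoidHom.coe_coe, add_comm, ← hn]
    exact sigma_det_mul_det_eq_pow σ hJ ((hG p).1 hp)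
  have h := (map_div_pow_mul_div_pow_eq_iff σ ι hσι (Matrix.GeneralLinearGroup.det p.1) p.2 1 k).2 hdet
  rwa [pow_one] at h

/-- **`n` odd: `c(GU(J)(A)) = {t : ι t is a `σ`-norm}` exactly** — `⊆` by the previous theorem, `⊇` by the scalar
similitudes. [cite: Kottwitz1992, §7 p. 394] -/
theorem mem_range_snd_iff_of_card_eq (hσι : ∀ a, σ (ι a) = ι a) (hJ : IsUnit J.det)
    (hG : ∀ p, p ∈ G ↔ ((p.1 : Matrix n n R).map σ)ᵀ * J * (p.1 : Matrix n n R) = ι (p.2 : A) • J)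
    {c : G →* Aˣ} (hc : ∀ p, c p = ((p : GL n R × Aˣ)).2) {k : ℕ} (hn : Fintype.card n = 2 * k + 1) (t : Aˣ) :
    t ∈ c.range ↔ ∃ z : Rˣ, Units.map (σ : R →* R) z * z = Units.map (ι : A →* R) t := by
  constructor
  · rintro ⟨p, rfl⟩
    rw [hc]
    exact ⟨_, exists_map_mul_eq_of_mem_of_card_eq σ ι hσι hJ hG hn p.2⟩
  · rintro ⟨z, hz⟩
    exact snd_mem_range_of_map_mul_eq σ ι hG hc hz

end Tower

/-! ## §2 Over a field: the image of `(det, c)` is `D_n ∩ (Kˣ × c(G))`; `n` odd ⟹ onto, `G ∕ SU ≅ D_n` -/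

section Field

variable {K A : Type*} [Field K] [CommRing A] {σ : K →+* K} (ι : A →+* K) {n : Type*} [Fintype n] [DecidableEq n]
  {J : Matrix n n K} {G : Subgroup (GL n K × Aˣ)}

/-- **Every `x` with `N x = ι(t)ⁿ` is a determinant in the fibre `c = t`** (non-degenerate hermitian `J` of non-zero size over
a field with `2 ≠ 0`, `σ` an involution with `σ θ₀ = −θ₀ ≠ 0`): if `(g₀, t) ∈ GU(J)(A)` and `σ(x) x = ι(t)ⁿ` then
`(g₀ u, t) ∈ GU(J)(A)` has determinant `x` for a `u ∈ U(J)` with `det u = x / det g₀` — a norm-one unit, hence a determinant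
of `U(J)` by Dieudonné's theorem (✔ `UnitaryIsotropic.exists_det_eq_units`).
[cite: Dieudonne1971GroupesClassiques, Chap. II §5] [cite: Kottwitz1992, §7 p. 393] -/
theorem exists_mem_det_eq [Nonempty n] (hσ : ∀ x : K, σ (σ x) = x) {θ₀ : K} (hθ : σ θ₀ = -θ₀) (hθ0 : θ₀ ≠ 0)
    (h2 : (2 : K) ≠ 0) (hJh : (J.map σ)ᵀ = J) (hJdet : J.det ≠ 0)
    (hG : ∀ p, p ∈ G ↔ ((p.1 : Matrix n n K).map σ)ᵀ * J * (p.1 : Matrix n n K) = ι (p.2 : A) • J)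
    {p₀ : GL n K × Aˣ} (hp₀ : p₀ ∈ G) {x : Kˣ}
    (hx : Units.map (σ : K →* K) x * x = Units.map (ι : A →* K) p₀.2 ^ Fintype.card n) :
    ∃ p ∈ G, p.2 = p₀.2 ∧ Matrix.GeneralLinearGroup.det p.1 = x := by
  have hg₀ := (hG p₀).1 hp₀
  have hdet₀ : Units.map (σ : K →* K) (Matrix.GeneralLinearGroup.det p₀.1) * Matrix.GeneralLinearGroup.det p₀.1 =
      Units.map (ι : A →* K) p₀.2 ^ Fintype.card n := by
    ext
    rw [Units.val_mul, Units.coe_map, MonoidHom.coe_coe, Matrix.GeneralLinearGroup.val_det_apply,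
      Units.val_pow_eq_pow_val, Units.coe_map, MonoidHom.coe_coe]
    exact sigma_det_mul_det_eq_pow σ hJdet.isUnit hg₀
  -- the correcting determinant `ε = x / det g₀` has `σ`-norm one
  have hε : σ ((x / Matrix.GeneralLinearGroup.det p₀.1 : Kˣ) : K) * (x / Matrix.GeneralLinearGroup.det p₀.1 : Kˣ) = 1 := by
    have h : Units.map (σ : K →* K) (x / Matrix.GeneralLinearGroup.det p₀.1) * (x / Matrix.GeneralLinearGroup.det p₀.1)
        = 1 := by
      rw [map_div, div_mul_div_comm, hx, hdet₀, div_self']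
    have h' := congrArg Units.val h
    rwa [Units.val_mul, Units.coe_map, MonoidHom.coe_coe, Units.val_one] at h'
  obtain ⟨u, hu⟩ := UnitaryIsotropic.exists_det_eq_units hσ hθ hθ0 h2 J hJh hJdet _ hε
  refine ⟨(p₀.1 * (u : GL n K), p₀.2), ?_, rfl, ?_⟩
  · rw [hG]
    have hu1 : (((u : GL n K) : Matrix n n K).map σ)ᵀ * J * ((u : GL n K) : Matrix n n K) = (1 : K) • J := by
      rw [one_smul]; exact mem_unitaryGroupOfForm_iff.1 u.2
    have h := mul_similitude σ hg₀ hu1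
    rwa [mul_one, ← Units.val_mul] at h
  · rw [map_mul, hu, mul_div_cancel]

/-- **The image of `(det, c)` is `D_n ∩ (Kˣ × c(G))`**: for `d = (x, t) ∈ D_n(A)`, `d` is `(det g, c(g))` for some
`g ∈ GU(J)(A)` IFF its multiplier coordinate `t` is a multiplier of some similitude (any parity of `n`).
[cite: Kottwitz1992, §7 pp. 393–394] [cite: Dieudonne1971GroupesClassiques, Chap. II §5] -/
theorem mem_range_iff_snd_mem_range [Nonempty n] (hσ : ∀ x : K, σ (σ x) = x) {θ₀ : K} (hθ : σ θ₀ = -θ₀) (hθ0 : θ₀ ≠ 0)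
    (h2 : (2 : K) ≠ 0) (hJh : (J.map σ)ᵀ = J) (hJdet : J.det ≠ 0)
    (hG : ∀ p, p ∈ G ↔ ((p.1 : Matrix n n K).map σ)ᵀ * J * (p.1 : Matrix n n K) = ι (p.2 : A) • J)
    {D : ℕ → Subgroup (Kˣ × Aˣ)}
    (hD : ∀ m p, p ∈ D m ↔ Units.map (σ : K →* K) p.1 * p.1 = Units.map (ι : A →* K) p.2 ^ m)
    {δ : G →* D (Fintype.card n)}
    (hδ : ∀ p : G, ((δ p : D (Fintype.card n)) : Kˣ × Aˣ) =
      (Matrix.GeneralLinearGroup.det (p : GL n K × Aˣ).1, (p : GL n K × Aˣ).2))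
    {c : G →* Aˣ} (hc : ∀ p, c p = ((p : GL n K × Aˣ)).2) (d : D (Fintype.card n)) :
    d ∈ δ.range ↔ ((d : Kˣ × Aˣ)).2 ∈ c.range := by
  constructor
  · rintro ⟨p, rfl⟩
    refine ⟨p, ?_⟩
    rw [hc, hδ]
  · rintro ⟨p₀, hp₀⟩
    rw [hc] at hp₀
    have hx : Units.map (σ : K →* K) ((d : Kˣ × Aˣ)).1 * ((d : Kˣ × Aˣ)).1 =
        Units.map (ι : A →* K) ((p₀ : GL n K × Aˣ)).2 ^ Fintype.card n := by
      rw [hp₀]; exact (hD _ _).1 d.2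
    obtain ⟨p, hpG, hp2, hp1⟩ := exists_mem_det_eq ι hσ hθ hθ0 h2 hJh hJdet hG p₀.2 hx
    refine ⟨⟨p, hpG⟩, Subtype.ext ?_⟩
    rw [hδ]
    exact Prod.ext hp1 (hp2.trans hp₀)

/-- If every base unit is a multiplier (`c` onto — e.g. the split form of §3), then `(det, c)` is onto `D_n(A)`.
[cite: Kottwitz1992, §7 pp. 393–394] -/
theorem range_eq_top_of_range_snd_eq_top [Nonempty n] (hσ : ∀ x : K, σ (σ x) = x) {θ₀ : K} (hθ : σ θ₀ = -θ₀)
    (hθ0 : θ₀ ≠ 0) (h2 : (2 : K) ≠ 0) (hJh : (J.map σ)ᵀ = J) (hJdet : J.det ≠ 0)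
    (hG : ∀ p, p ∈ G ↔ ((p.1 : Matrix n n K).map σ)ᵀ * J * (p.1 : Matrix n n K) = ι (p.2 : A) • J)
    {D : ℕ → Subgroup (Kˣ × Aˣ)}
    (hD : ∀ m p, p ∈ D m ↔ Units.map (σ : K →* K) p.1 * p.1 = Units.map (ι : A →* K) p.2 ^ m)
    {δ : G →* D (Fintype.card n)}
    (hδ : ∀ p : G, ((δ p : D (Fintype.card n)) : Kˣ × Aˣ) =
      (Matrix.GeneralLinearGroup.det (p : GL n K × Aˣ).1, (p : GL n K × Aˣ).2))
    {c : G →* Aˣ} (hc : ∀ p, c p = ((p : GL n K × Aˣ)).2) (htop : c.range = ⊤) : δ.range = ⊤ := by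
  rw [eq_top_iff]
  intro d _
  rw [mem_range_iff_snd_mem_range ι hσ hθ hθ0 h2 hJh hJdet hG hD hδ hc, htop]
  exact Subgroup.mem_top _

/-- **Kottwitz, Case A with `n = 2k + 1` odd: `(det, c) : GU(J)(A) → D_n(A)` is SURJECTIVE on points.**  For
`(x, t) ∈ D_n(A)` the shear `z = x ι(t)^{-k}` has `σ(z) z = ι t` (✔ `map_div_pow_mul_div_pow_eq_iff`), so `t` is the
multiplier of the scalar similitude `(z·1, t)`, and `U(J)` corrects the determinant (`exists_mem_det_eq`).
[cite: Kottwitz1992, §7 p. 394] [cite: Dieudonne1971GroupesClassiques, Chap. II §5] -/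
theorem surjective_of_card_eq (hσ : ∀ x : K, σ (σ x) = x) {θ₀ : K} (hθ : σ θ₀ = -θ₀) (hθ0 : θ₀ ≠ 0)
    (h2 : (2 : K) ≠ 0) (hσι : ∀ a, σ (ι a) = ι a) (hJh : (J.map σ)ᵀ = J) (hJdet : J.det ≠ 0)
    (hG : ∀ p, p ∈ G ↔ ((p.1 : Matrix n n K).map σ)ᵀ * J * (p.1 : Matrix n n K) = ι (p.2 : A) • J)
    {D : ℕ → Subgroup (Kˣ × Aˣ)}
    (hD : ∀ m p, p ∈ D m ↔ Units.map (σ : K →* K) p.1 * p.1 = Units.map (ι : A →* K) p.2 ^ m)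
    {δ : G →* D (Fintype.card n)}
    (hδ : ∀ p : G, ((δ p : D (Fintype.card n)) : Kˣ × Aˣ) =
      (Matrix.GeneralLinearGroup.det (p : GL n K × Aˣ).1, (p : GL n K × Aˣ).2))
    {k : ℕ} (hn : Fintype.card n = 2 * k + 1) : Function.Surjective δ := by
  haveI : Nonempty n := Fintype.card_pos_iff.1 (by omega)
  obtain ⟨c, hc⟩ := exists_monoidHom_snd (R := K) G
  intro d
  have hd : Units.map (σ : K →* K) ((d : Kˣ × Aˣ)).1 * ((d : Kˣ × Aˣ)).1 =
      Units.map (ι : A →* K) ((d : Kˣ × Aˣ)).2 ^ (1 + 2 * k) := by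
    rw [add_comm, ← hn]; exact (hD _ _).1 d.2
  have hz := (map_div_pow_mul_div_pow_eq_iff σ ι hσι ((d : Kˣ × Aˣ)).1 ((d : Kˣ × Aˣ)).2 1 k).2 hd
  rw [pow_one] at hz
  have hmem : d ∈ δ.range :=
    (mem_range_iff_snd_mem_range ι hσ hθ hθ0 h2 hJh hJdet hG hD hδ hc d).2
      (snd_mem_range_of_map_mul_eq σ ι hG hc hz)
  obtain ⟨p, hp⟩ := hmem
  exact ⟨p, hp⟩

/-- **Kottwitz: `D` is the quotient of `G` by its derived group — on points, `n` odd:**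
`GU(J)(A) ∕ ker(det, c) ≃* D_n(A)`, `[(g, t)] ↦ (det g, t)`, where `ker (det, c) = SU(J)(A) × {1}` (`ker_eq_map_ker_det`).
[cite: Kottwitz1992, §7 pp. 393–394] -/
theorem exists_mulEquiv_quotient_ker (hσ : ∀ x : K, σ (σ x) = x) {θ₀ : K} (hθ : σ θ₀ = -θ₀) (hθ0 : θ₀ ≠ 0)
    (h2 : (2 : K) ≠ 0) (hσι : ∀ a, σ (ι a) = ι a) (hJh : (J.map σ)ᵀ = J) (hJdet : J.det ≠ 0)
    (hG : ∀ p, p ∈ G ↔ ((p.1 : Matrix n n K).map σ)ᵀ * J * (p.1 : Matrix n n K) = ι (p.2 : A) • J)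
    {D : ℕ → Subgroup (Kˣ × Aˣ)}
    (hD : ∀ m p, p ∈ D m ↔ Units.map (σ : K →* K) p.1 * p.1 = Units.map (ι : A →* K) p.2 ^ m)
    {δ : G →* D (Fintype.card n)}
    (hδ : ∀ p : G, ((δ p : D (Fintype.card n)) : Kˣ × Aˣ) =
      (Matrix.GeneralLinearGroup.det (p : GL n K × Aˣ).1, (p : GL n K × Aˣ).2))
    {k : ℕ} (hn : Fintype.card n = 2 * k + 1) :
    ∃ e : G ⧸ δ.ker ≃* D (Fintype.card n), ∀ p : G, e (QuotientGroup.mk p) = δ p :=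
  ⟨QuotientGroup.quotientKerEquivOfSurjective δ (surjective_of_card_eq ι hσ hθ hθ0 h2 hσι hJh hJdet hG hD hδ hn),
    fun p => QuotientGroup.kerLift_mk δ p⟩

/-- **Matrix-level headline, `n` odd**: every pair `(x, t) ∈ Kˣ × Aˣ` with `σ(x) x = ι(t)ⁿ` is `(det g, c(g))` for a
unitary similitude `g`, `ᵗσ(g) J g = ι(t) J` (non-degenerate hermitian `J`, field with `2 ≠ 0`, involution `σ ≠ 1`).
[cite: Kottwitz1992, §7 p. 394] [cite: Dieudonne1971GroupesClassiques, Chap. II §5] -/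
theorem exists_similitude_det_eq_of_card_eq (hσ : ∀ x : K, σ (σ x) = x) {θ₀ : K} (hθ : σ θ₀ = -θ₀) (hθ0 : θ₀ ≠ 0)
    (h2 : (2 : K) ≠ 0) (hσι : ∀ a, σ (ι a) = ι a) (hJh : (J.map σ)ᵀ = J) (hJdet : J.det ≠ 0)
    {k : ℕ} (hn : Fintype.card n = 2 * k + 1) (x : Kˣ) (t : Aˣ)
    (hx : Units.map (σ : K →* K) x * x = Units.map (ι : A →* K) t ^ Fintype.card n) :
    ∃ g : GL n K, ((g : Matrix n n K).map σ)ᵀ * J * (g : Matrix n n K) = ι (t : A) • J ∧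
      Matrix.GeneralLinearGroup.det g = x := by
  haveI : Nonempty n := Fintype.card_pos_iff.1 (by omega)
  obtain ⟨G, hG⟩ := exists_subgroup_forall_mem_iff σ ι (A := A) J
  have hd : Units.map (σ : K →* K) x * x = Units.map (ι : A →* K) t ^ (1 + 2 * k) := by
    rw [add_comm, ← hn]; exact hx
  have hz := (map_div_pow_mul_div_pow_eq_iff σ ι hσι x t 1 k).2 hd
  rw [pow_one] at hz
  have hp₀ : (Matrix.GeneralLinearGroup.scalar n (x / Units.map (ι : A →* K) t ^ k), t) ∈ G := scalar_mk_mem σ ι hG hz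
  obtain ⟨p, hpG, hp2, hp1⟩ := exists_mem_det_eq ι hσ hθ hθ0 h2 hJh hJdet hG hp₀ (x := x) hx
  refine ⟨p.1, ?_, hp1⟩
  have h := (hG p).1 hpG
  rw [hp2] at h
  exact h

end Field

/-! ## §3 The split even case `J = [[0, 1], [1, 0]]`: every base unit is a multiplier, `(det, c)` is onto -/

section Split

variable {R A : Type*} [CommRing R] [CommRing A] (σ : R →+* R) (ι : A →+* R) {m : Type*} [Fintype m] [DecidableEq m]

omit [Fintype m] in
/-- The split hermitian form `J = [[0, 1], [1, 0]]` on `m ⊕ m` is `σ`-hermitian: `(J.map σ)ᵀ = J`. [folklore] -/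
private theorem map_transpose_fromBlocks_swap :
    ((Matrix.fromBlocks (0 : Matrix m m R) (1 : Matrix m m R) (1 : Matrix m m R) 0).map σ)ᵀ = Matrix.fromBlocks (0 : Matrix m m R) (1 : Matrix m m R) (1 : Matrix m m R) 0 := by
  rw [Matrix.fromBlocks_map, Matrix.fromBlocks_transpose, Matrix.map_zero σ (map_zero σ),
    Matrix.map_one σ (map_zero σ) (map_one σ), Matrix.transpose_zero, Matrix.transpose_one]

/-- `det [[0, 1], [1, 0]]` is a unit (it is `±1`). [folklore] -/
private theorem isUnit_det_fromBlocks_swap :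
    IsUnit (Matrix.fromBlocks (0 : Matrix m m R) (1 : Matrix m m R) (1 : Matrix m m R) 0).det := by
  have h : Matrix.fromBlocks (0 : Matrix m m R) (1 : Matrix m m R) (1 : Matrix m m R) 0 * Matrix.fromBlocks (0 : Matrix m m R) (1 : Matrix m m R) (1 : Matrix m m R) 0 = 1 := by
    rw [Matrix.fromBlocks_multiply]; simp
  exact IsUnit.of_mul_eq_one _ (by rw [← Matrix.det_mul, h, Matrix.det_one])

/-- **`g_t = diag(ι(t)·1_m, 1_m)` is a similitude of the split form with multiplier `ι t`**:
`ᵗσ(g_t) [[0,1],[1,0]] g_t = ι(t) [[0,1],[1,0]]` (`σ ∘ ι = ι`). [cite: Kottwitz1992, §7 p. 393] -/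
theorem fromBlocks_smul_one_similitude (hσι : ∀ a, σ (ι a) = ι a) (t : A) :
    ((Matrix.fromBlocks ((ι t) • (1 : Matrix m m R)) 0 0 (1 : Matrix m m R)).map σ)ᵀ * Matrix.fromBlocks (0 : Matrix m m R) (1 : Matrix m m R) (1 : Matrix m m R) 0 *
        Matrix.fromBlocks ((ι t) • (1 : Matrix m m R)) 0 0 (1 : Matrix m m R) = ι t • Matrix.fromBlocks (0 : Matrix m m R) (1 : Matrix m m R) (1 : Matrix m m R) 0 := by
  have hmap : (Matrix.fromBlocks ((ι t) • (1 : Matrix m m R)) 0 0 (1 : Matrix m m R)).map σ =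
      Matrix.fromBlocks ((ι t) • (1 : Matrix m m R)) 0 0 (1 : Matrix m m R) := by
    rw [Matrix.fromBlocks_map, Matrix.map_zero σ (map_zero σ), Matrix.map_one σ (map_zero σ) (map_one σ)]
    congr 1
    ext i j
    simp [Matrix.one_apply, hσι, apply_ite σ]
  rw [hmap, Matrix.fromBlocks_transpose, Matrix.transpose_smul, Matrix.transpose_one, Matrix.transpose_zero,
    Matrix.fromBlocks_multiply, Matrix.fromBlocks_multiply, Matrix.fromBlocks_smul]
  simp

/-- `g_t` as an element of `GL_{m ⊕ m}(R)` (inverse `g_{t⁻¹}`): there is an invertible matrix equal to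
`diag(ι(t)·1, 1)`. [folklore] -/
private theorem exists_gl_fromBlocks (t : Aˣ) :
    ∃ g : GL (m ⊕ m) R, (g : Matrix (m ⊕ m) (m ⊕ m) R) = Matrix.fromBlocks ((ι (t : A)) • (1 : Matrix m m R)) 0 0 (1 : Matrix m m R) := by
  have hmul : ∀ s s' : Aˣ, Matrix.fromBlocks ((ι (s : A)) • (1 : Matrix m m R)) 0 0 (1 : Matrix m m R) *
      Matrix.fromBlocks ((ι (s' : A)) • (1 : Matrix m m R)) 0 0 (1 : Matrix m m R) =
        Matrix.fromBlocks ((ι ((s * s' : Aˣ) : A)) • (1 : Matrix m m R)) 0 0 (1 : Matrix m m R) := by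
    intro s s'
    rw [Matrix.fromBlocks_multiply]
    simp [smul_smul, Units.val_mul, map_mul, mul_comm]
  refine ⟨⟨Matrix.fromBlocks ((ι (t : A)) • (1 : Matrix m m R)) 0 0 (1 : Matrix m m R),
    Matrix.fromBlocks ((ι ((t⁻¹ : Aˣ) : A)) • (1 : Matrix m m R)) 0 0 (1 : Matrix m m R), ?_, ?_⟩, rfl⟩
  · rw [hmul, mul_inv_cancel, Units.val_one, map_one, one_smul, Matrix.fromBlocks_one]
  · rw [hmul, inv_mul_cancel, Units.val_one, map_one, one_smul, Matrix.fromBlocks_one]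

/-- **Split form, any `m`: every base unit is a multiplier**, `c(GU([[0,1],[1,0]])(A)) = Aˣ` — the similitude `(g_t, t)`.
[cite: Kottwitz1992, §7 p. 393] -/
theorem range_snd_eq_top_of_fromBlocks (hσι : ∀ a, σ (ι a) = ι a) {G : Subgroup (GL (m ⊕ m) R × Aˣ)}
    (hG : ∀ p, p ∈ G ↔ ((p.1 : Matrix (m ⊕ m) (m ⊕ m) R).map σ)ᵀ * Matrix.fromBlocks (0 : Matrix m m R) (1 : Matrix m m R) (1 : Matrix m m R) 0 *
      (p.1 : Matrix (m ⊕ m) (m ⊕ m) R) = ι (p.2 : A) • Matrix.fromBlocks (0 : Matrix m m R) (1 : Matrix m m R) (1 : Matrix m m R) 0)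
    {c : G →* Aˣ} (hc : ∀ p, c p = ((p : GL (m ⊕ m) R × Aˣ)).2) : c.range = ⊤ := by
  rw [eq_top_iff]
  intro t _
  obtain ⟨g, hg⟩ := exists_gl_fromBlocks ι (R := R) (m := m) t
  have hmem : (g, t) ∈ G := by
    rw [hG, hg]
    exact fromBlocks_smul_one_similitude σ ι hσι (t : A)
  exact ⟨⟨(g, t), hmem⟩, by rw [hc]⟩

/-- **Split form over a field: `(det, c) : GU(J)(A) → D_{2|m|}(A)` is onto** (`m` non-empty; `σ` an involution with
`σ θ₀ = −θ₀ ≠ 0`, `2 ≠ 0`) — for the quasi-split unitary similitude group in an even number of variables the map to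
Kottwitz's `D` is surjective on points as well. [cite: Kottwitz1992, §7 pp. 393–394]
[cite: Dieudonne1971GroupesClassiques, Chap. II §5] -/
theorem surjective_of_fromBlocks {K : Type*} [Field K] {σ : K →+* K} (ι : A →+* K) [Nonempty m]
    (hσ : ∀ x : K, σ (σ x) = x) {θ₀ : K} (hθ : σ θ₀ = -θ₀) (hθ0 : θ₀ ≠ 0) (h2 : (2 : K) ≠ 0) (hσι : ∀ a, σ (ι a) = ι a)
    {G : Subgroup (GL (m ⊕ m) K × Aˣ)}
    (hG : ∀ p, p ∈ G ↔ ((p.1 : Matrix (m ⊕ m) (m ⊕ m) K).map σ)ᵀ * Matrix.fromBlocks (0 : Matrix m m K) (1 : Matrix m m K) (1 : Matrix m m K) 0 *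
      (p.1 : Matrix (m ⊕ m) (m ⊕ m) K) = ι (p.2 : A) • Matrix.fromBlocks (0 : Matrix m m K) (1 : Matrix m m K) (1 : Matrix m m K) 0)
    {D : ℕ → Subgroup (Kˣ × Aˣ)}
    (hD : ∀ r p, p ∈ D r ↔ Units.map (σ : K →* K) p.1 * p.1 = Units.map (ι : A →* K) p.2 ^ r)
    {δ : G →* D (Fintype.card (m ⊕ m))}
    (hδ : ∀ p : G, ((δ p : D (Fintype.card (m ⊕ m))) : Kˣ × Aˣ) =
      (Matrix.GeneralLinearGroup.det (p : GL (m ⊕ m) K × Aˣ).1, (p : GL (m ⊕ m) K × Aˣ).2)) :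
    Function.Surjective δ := by
  obtain ⟨c, hc⟩ := exists_monoidHom_snd (R := K) G
  have htop := range_eq_top_of_range_snd_eq_top ι hσ hθ hθ0 h2 (map_transpose_fromBlocks_swap σ)
    (isUnit_det_fromBlocks_swap (R := K) (m := m)).ne_zero hG hD hδ hc (range_snd_eq_top_of_fromBlocks σ ι hσι hG hc)
  exact MonoidHom.range_eq_top.1 htop

end Split

/-! ## §4 The derived group on points: `GU(J)(A)′ = ker (det, c) = j(SU(J))` for isotropic `J`; `GU^{ab} ≅ D_n` (`n` odd) -/

section Derived

variable {R A : Type*} [CommRing R] [CommRing A] {n : Type*} [Fintype n] [DecidableEq n]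
  {G : Subgroup (GL n R × Aˣ)}

/-- `(det, c)` kills commutators: the commutator subgroup of `GU(J)(A)` lies in `ker (det, c)` (the target `D_n(A) ≤ Rˣ × Aˣ`
is commutative) — any commutative tower. [cite: Kottwitz1992, §7 p. 393] -/
theorem commutator_le_ker {m : ℕ} {D : ℕ → Subgroup (Rˣ × Aˣ)} (δ : G →* D m) : commutator ↥G ≤ δ.ker :=
  Abelianization.commutator_subset_ker δ

/-- `j(U(J)′) ≤ GU(J)′`: commutators of unitary matrices are commutators of similitudes (`G₁ ⊂ G`). [folklore] -/
private theorem map_commutator_le {U : Type*} [Group U] (j : U →* G) : (commutator U).map j ≤ commutator ↥G := by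
  rw [commutator_def, commutator_def, Subgroup.map_commutator]
  exact Subgroup.commutator_mono le_top le_top

variable {K : Type*} [Field K] {σ : K →+* K} (ι : A →+* K) {J : Matrix n n K} {G' : Subgroup (GL n K × Aˣ)}

/-- **The derived group on points: `GU(J)(A)′ = ker (det, c)`** for a non-degenerate hermitian `J` admitting an ISOTROPIC
vector (field with `2 ≠ 0`, involution `σ` with `σ θ₀ = −θ₀ ≠ 0`): `≤` because `D_n` is commutative, `≥` because
`ker (det, c) = j(SU(J))` (`ker_eq_map_ker_det`) and `SU(J) = U(J)′` (✔ `UnitaryIsotropic.commutator_eq_ker_det`,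
Dieudonné).  This is Kottwitz's «the quotient of `G` by its derived group» with the derived group read on `A`-points.
[cite: Kottwitz1992, §7 p. 393] [cite: Dieudonne1971GroupesClassiques, Chap. II §5] -/
theorem commutator_eq_ker (hσ : ∀ x : K, σ (σ x) = x) {θ₀ : K} (hθ : σ θ₀ = -θ₀) (hθ0 : θ₀ ≠ 0) (h2 : (2 : K) ≠ 0)
    (hJh : (J.map σ)ᵀ = J) (hJdet : J.det ≠ 0)
    (hiso : ∃ x : n → K, x ≠ 0 ∧ dotProduct (fun i => σ (x i)) (J.mulVec x) = 0)
    (hG : ∀ p, p ∈ G' ↔ ((p.1 : Matrix n n K).map σ)ᵀ * J * (p.1 : Matrix n n K) = ι (p.2 : A) • J)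
    {j : ↥(unitaryGroupOfForm σ J) →* G'} (hj : ∀ u, ((j u : G') : GL n K × Aˣ) = ((u : GL n K), 1))
    {m : ℕ} {D : ℕ → Subgroup (Kˣ × Aˣ)} {δ : G' →* D m}
    (hδ : ∀ p : G', ((δ p : D m) : Kˣ × Aˣ) = (Matrix.GeneralLinearGroup.det (p : GL n K × Aˣ).1, (p : GL n K × Aˣ).2)) :
    commutator ↥G' = δ.ker := by
  refine le_antisymm (commutator_le_ker δ) ?_
  rw [ker_eq_map_ker_det σ ι hG hj hδ, ← UnitaryIsotropic.commutator_eq_ker_det hσ hθ hθ0 h2 J hJh hJdet hiso]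
  exact map_commutator_le j

/-- **`GU(J)(A)′ = j(SU(J)(A))`** (isotropic `J` over a field): the commutator subgroup of the similitude group on points is
the determinant-one unitary group embedded by `u ↦ (u, 1)`. [cite: Kottwitz1992, §7 p. 393]
[cite: Dieudonne1971GroupesClassiques, Chap. II §5] -/
theorem commutator_eq_map_ker_det (hσ : ∀ x : K, σ (σ x) = x) {θ₀ : K} (hθ : σ θ₀ = -θ₀) (hθ0 : θ₀ ≠ 0)
    (h2 : (2 : K) ≠ 0) (hJh : (J.map σ)ᵀ = J) (hJdet : J.det ≠ 0)
    (hiso : ∃ x : n → K, x ≠ 0 ∧ dotProduct (fun i => σ (x i)) (J.mulVec x) = 0)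
    (hG : ∀ p, p ∈ G' ↔ ((p.1 : Matrix n n K).map σ)ᵀ * J * (p.1 : Matrix n n K) = ι (p.2 : A) • J)
    {j : ↥(unitaryGroupOfForm σ J) →* G'} (hj : ∀ u, ((j u : G') : GL n K × Aˣ) = ((u : GL n K), 1)) :
    commutator ↥G' = ((Matrix.GeneralLinearGroup.det.comp (unitaryGroupOfForm σ J).subtype).ker).map j := by
  obtain ⟨D, hD⟩ := exists_forall_mem_iff σ ι (R := K) (A := A)
  obtain ⟨δ, hδ⟩ := exists_monoidHom_det σ ι hJdet.isUnit hG hD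
  rw [commutator_eq_ker ι hσ hθ hθ0 h2 hJh hJdet hiso hG hj hδ, ker_eq_map_ker_det σ ι hG hj hδ]

/-- **`GU(J)(A)^{ab} ≅ D_n(A)` for `n` odd** (isotropic non-degenerate hermitian `J` over a field, `σ ∘ ι = ι`): the
homomorphism `GU^{ab} → D_n`, `[(g, t)] ↦ (det g, t)` induced by `(det, c)` is BIJECTIVE — Kottwitz's torus `D` IS the
maximal abelian quotient of `G` on points. [cite: Kottwitz1992, §7 pp. 393–394]
[cite: Dieudonne1971GroupesClassiques, Chap. II §5] -/
theorem bijective_abelianizationLift (hσ : ∀ x : K, σ (σ x) = x) {θ₀ : K} (hθ : σ θ₀ = -θ₀) (hθ0 : θ₀ ≠ 0)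
    (h2 : (2 : K) ≠ 0) (hσι : ∀ a, σ (ι a) = ι a) (hJh : (J.map σ)ᵀ = J) (hJdet : J.det ≠ 0)
    (hiso : ∃ x : n → K, x ≠ 0 ∧ dotProduct (fun i => σ (x i)) (J.mulVec x) = 0)
    (hG : ∀ p, p ∈ G' ↔ ((p.1 : Matrix n n K).map σ)ᵀ * J * (p.1 : Matrix n n K) = ι (p.2 : A) • J)
    {D : ℕ → Subgroup (Kˣ × Aˣ)}
    (hD : ∀ m p, p ∈ D m ↔ Units.map (σ : K →* K) p.1 * p.1 = Units.map (ι : A →* K) p.2 ^ m)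
    {δ : G' →* D (Fintype.card n)}
    (hδ : ∀ p : G', ((δ p : D (Fintype.card n)) : Kˣ × Aˣ) =
      (Matrix.GeneralLinearGroup.det (p : GL n K × Aˣ).1, (p : GL n K × Aˣ).2))
    {k : ℕ} (hn : Fintype.card n = 2 * k + 1) : Function.Bijective (Abelianization.lift δ) := by
  obtain ⟨j, -, hj⟩ := exists_monoidHom_inl σ ι hG
  have hker : δ.ker = commutator ↥G' := (commutator_eq_ker ι hσ hθ hθ0 h2 hJh hJdet hiso hG hj hδ).symm
  have hofs : Function.Surjective (Abelianization.of : ↥G' →* Abelianization ↥G') :=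
    fun x => QuotientGroup.induction_on x fun g => ⟨g, rfl⟩
  constructor
  · rw [← MonoidHom.ker_eq_bot_iff, eq_bot_iff]
    intro x hx
    obtain ⟨g, rfl⟩ := hofs x
    rw [MonoidHom.mem_ker, Abelianization.lift_apply_of] at hx
    have hg : g ∈ δ.ker := hx
    rw [hker, ← Abelianization.ker_of] at hg
    rw [Subgroup.mem_bot]
    exact (MonoidHom.mem_ker).1 hg
  · intro y
    obtain ⟨g, rfl⟩ := surjective_of_card_eq ι hσ hθ hθ0 h2 hσι hJh hJdet hG hD hδ hn y
    exact ⟨Abelianization.of g, Abelianization.lift_apply_of _ _⟩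

/-- … packaged as a group isomorphism `GU(J)(A)^{ab} ≃* D_n(A)` with `[p] ↦ (det p.1, p.2)`.
[cite: Kottwitz1992, §7 pp. 393–394] -/
theorem exists_mulEquiv_abelianization (hσ : ∀ x : K, σ (σ x) = x) {θ₀ : K} (hθ : σ θ₀ = -θ₀) (hθ0 : θ₀ ≠ 0)
    (h2 : (2 : K) ≠ 0) (hσι : ∀ a, σ (ι a) = ι a) (hJh : (J.map σ)ᵀ = J) (hJdet : J.det ≠ 0)
    (hiso : ∃ x : n → K, x ≠ 0 ∧ dotProduct (fun i => σ (x i)) (J.mulVec x) = 0)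
    (hG : ∀ p, p ∈ G' ↔ ((p.1 : Matrix n n K).map σ)ᵀ * J * (p.1 : Matrix n n K) = ι (p.2 : A) • J)
    {D : ℕ → Subgroup (Kˣ × Aˣ)}
    (hD : ∀ m p, p ∈ D m ↔ Units.map (σ : K →* K) p.1 * p.1 = Units.map (ι : A →* K) p.2 ^ m)
    {δ : G' →* D (Fintype.card n)}
    (hδ : ∀ p : G', ((δ p : D (Fintype.card n)) : Kˣ × Aˣ) =
      (Matrix.GeneralLinearGroup.det (p : GL n K × Aˣ).1, (p : GL n K × Aˣ).2))
    {k : ℕ} (hn : Fintype.card n = 2 * k + 1) :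
    ∃ e : Abelianization ↥G' ≃* D (Fintype.card n), ∀ p : G', e (Abelianization.of p) = δ p :=
  ⟨MulEquiv.ofBijective (Abelianization.lift δ)
      (bijective_abelianizationLift ι hσ hθ hθ0 h2 hσι hJh hJdet hiso hG hD hδ hn),
    fun p => Abelianization.lift_apply_of δ p⟩

end Derived

end Literature.NumberTheory.Automorphic.UnitarySimilitude
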